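import Summits.Ventures.CertifiedManyBodySolver.Downfold.EmeryBoxesHg1201CGWSICThermalCapRetiltMarkovBoxp1
import Summits.Ventures.CertifiedManyBodySolver.Downfold.EmeryBoxesHg1201CGWSICThermalFloorAtlasWord
import Summits.Ventures.CertifiedManyBodySolver.Downfold.EmeryThermalAtomicFloor
import HarnessLib

/-!
# HIGH-TEMPERATURE-CLOSING `T > 0` WINDOW on HgBa2CuO4 (M19) U-SLICE «cGW-SIC» (8.837, 5.311) [Hirayama] — `emeryBoxHg1201CGWSIC` (router/EMERY-FLOOR-ORDERS row 9): the ATOMIC-LIMIT floor (full entropy) ∨ the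
# family floor, against the re-tilted cap — both sides meet at `6 log 2` as β → 0

Venture CertifiedManyBodySolver, cell `pub/hubbard-downfold` (S1 = ROUTER) × crew hubbard-fast S2 (ii) × (iv) «T > 0 × multi-band» (D-0096 (ii)); seat hubbard-downfold-mod-4
(S1/S2 Emery seam, g17). Namespace `Summit.Ventures.CertifiedManyBodySolver.Downfold`. DOOR: `EmeryThermalAtomicFloor` (`holdsOn_emeryCellPressureAtomicFloor`: Peierls on the
whole occupation basis of the `Cu₄O₈` block, site-wise factorisation; the one-site function is the tree's `atomicPartitionFnReal β U μ`). INPUTS BY NAME: the family floor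
`emeryBoxHg1201CGWSIC_pressureFloorFam_m49o5` (`EmeryBoxesHg1201CGWSICThermalFloorAtlasWord`; C = (-154.853677, -154.766760)), the cap `emeryBoxHg1201CGWSIC_pressureCap_m49o5_retilt` (`EmeryBoxesHg1201CGWSICThermalCapRetiltMarkovBoxp1`; `6 log 2 + 44.1755·β`; flat word 48.5755).
ATOMIC DATA: Cu at `μ_d = −(εp + Δ_hi) = 917/100`, `U_d,hi = 8837/1000`; O at `μ_p = −εp = 49/5`, `U_p,hi = 5311/1000` ⇒ classical slope 38.0810·β (family slope 38.7134; cap 44.1755).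
RESULT: **`emeryBoxHg1201CGWSIC_pressureWindowHighT_m49o5`**: `max(atomic, family) ≤ P_cell ≤ 6 log 2 + 44.1755·β` on the whole box, every β ≥ 0; width → 0 as β → 0 (both sides `6 log 2`,
`emeryBoxHg1201CGWSIC_pressure_beta_zero_m49o5`); crossover β* ≈ 1.144 (T* ≈ 10143 K) below which the atomic floor is the better floor [float].

Everything PROVED (0 sorry); no definition. HONEST FRAMING: CERTIFIED inequalities on a SCREENING/EXTRAPOLATED-grade object; the atomic floor ignores hopping (its slope sits
0.6324 below the family floor's), so at physical temperatures (β ≈ 20–40 eV⁻¹) the family floor still decides and thermal scales are NOT resolved there; what is new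
is the correct INFINITE-TEMPERATURE closure of the window and a certified high-T regime (β ≲ β*) with width `≈ 6.0945·β`; grand-canonical at the stated level; no phase word;
no router number moves. WHAT-THIS-IS-NOT: a new certificate (pure algebra on landed objects; zero kit).
-/

noncomputable section

namespace Summit.Ventures.CertifiedManyBodySolver.Downfold

open NonemptyInterval Matrix Finset Literature.Probability.LatticeModels
open Literature.MathematicalPhysics.QuantumLattice Literature.Computation.Certificates
open Summit.Ventures.CertifiedManyBodySolver.Certificates OccupationCode ClusterLowerBound
open scoped BigOperators ComplexOrder

/-! ## §1 The atomic-limit floor on the box at εp = -49/5 -/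

/-- **ATOMIC-LIMIT `T > 0` FLOOR** on the whole `emeryBoxHg1201CGWSIC`, cuprate signs, level εp = -49/5 (chemical potential 49/5 eV), EVERY β ≥ 0:
`log z₀(β; U_d = 8837/1000, μ_d = 917/100) + 2·log z₀(β; U_p = 5311/1000, μ_p = 49/5) ≤ P_cell` with `z₀(β; U, μ) = 1 + 2e^{βμ} + e^{−β(U−2μ)}` (`atomicPartitionFnReal`; Cu at the
box's upper level `εp + Δ_hi = -917/100` and `U_d,hi`, O at `εp` and `U_p,hi`). Value `6 log 2` at β = 0; slope `38.0810·β` as β → ∞ (classical minimum, no hopping).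
[cite: Ruelle1969, §2.5–2.6] [cite: Ueltschi1999, §3] -/
theorem emeryBoxHg1201CGWSIC_pressureAtomicFloor_m49o5 {β : ℝ} (hβ : 0 ≤ β) :
    HoldsOn (fun p : EmeryCoord → ℝ => Real.log (atomicPartitionFnReal β (8837/1000 : ℝ) (917/100 : ℝ)) + 2 * Real.log (atomicPartitionFnReal β (5311/1000 : ℝ) (49/5 : ℝ)) ≤ emeryCellPressure β (emeryLine cuprateSigns (emeryLineCoords (((-49/5 : ℚ)) : ℝ) p))) emeryBoxHg1201CGWSIC := by
  intro p hp
  have h := holdsOn_emeryCellPressureAtomicFloor (E := emeryBoxHg1201CGWSIC) (eA := hg1201Emery_tpd) (eB := hg1201Emery_tpp) (eD := hg1201CGWSICEmery_Delta) (eUd := hg1201CGWSICEmery_Udd) (eUp := hg1201CGWSICEmery_Upp) (-49/5) (by simp [emeryBoxHg1201CGWSIC, emeryBoxHg1201CGWSICSrc, Function.update]) (by simp [emeryBoxHg1201CGWSIC, emeryBoxHg1201CGWSICSrc, Function.update]) (Function.update_self _ _ _) (by simp [emeryBoxHg1201CGWSIC, emeryBoxHg1201CGWSICSrc, Function.update])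 (by simp [emeryBoxHg1201CGWSIC, emeryBoxHg1201CGWSICSrc, Function.update]) cuprateSigns hβ p hp
  simp only [hg1201CGWSICEmery_Delta, hg1201CGWSICEmery_Udd, hg1201CGWSICEmery_Upp, Entry.encl_ofEnds_snd] at h
  push_cast at h
  norm_num at h ⊢
  exact h

/-! ## §2 The best floor and the HIGH-TEMPERATURE-CLOSING window -/

/-- **BEST `T > 0` FLOOR = max(atomic, family)** on the whole box at εp = -49/5, every β ≥ 0: the atomic floor (full entropy, slope 38.0810) wins for
β < β* ≈ 1.144 (T > 10143 K), the family floor `emeryBoxHg1201CGWSIC_pressureFloorFam_m49o5` (slope 38.7134, entropy ¼·log 2) for β > β*. [cite: Ruelle1969, §2.5–2.6] [cite: Israel1979, Lemma II.3.1] -/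
theorem emeryBoxHg1201CGWSIC_pressureFloorBest_m49o5 {β : ℝ} (hβ : 0 ≤ β) :
    HoldsOn (fun p : EmeryCoord → ℝ => max (Real.log (atomicPartitionFnReal β (8837/1000 : ℝ) (917/100 : ℝ)) + 2 * Real.log (atomicPartitionFnReal β (5311/1000 : ℝ) (49/5 : ℝ))) (Real.log (Real.exp (-(β * (-154853677/1000000 : ℝ))) + Real.exp (-(β * (-3869169/25000 : ℝ)))) / 4) ≤ emeryCellPressure β (emeryLine cuprateSigns (emeryLineCoords (((-49/5 : ℚ)) : ℝ) p))) emeryBoxHg1201CGWSIC :=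
  fun p hp => max_le (emeryBoxHg1201CGWSIC_pressureAtomicFloor_m49o5 hβ p hp) (emeryBoxHg1201CGWSIC_pressureFloorFam_m49o5 hβ p hp)

/-- **THE HIGH-TEMPERATURE-CLOSING TWO-SIDED `T > 0` WINDOW** (hypothesis-free on both sides) on the whole `emeryBoxHg1201CGWSIC`, level εp = -49/5, EVERY β ≥ 0:
`max(atomic, family) ≤ P_cell ≤ 6 log 2 + β·7068077/160000` (cap = `emeryBoxHg1201CGWSIC_pressureCap_m49o5_retilt`, hubbard-box-p1 re-tilted). BOTH SIDES EQUAL `6 log 2` AT β = 0; the width is `O(β)` for small β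
(slope gap 6.0945 against the atomic floor, 5.4621 against the family floor). Table [float; `T = 11604.5/β` K]:
| β (1/eV) | T (K) | atomic floor | family floor | best floor | cap | width |
|---|---|---|---|---|---|---|
| 0.01 | 1160450 | 4.4014 | 0.5603 | 4.4014 | 4.6006 | 0.1992 |
| 0.1 | 116045 | 6.8539 | 4.0435 | 6.8539 | 8.5764 | 1.7225 |
| 0.5 | 23209 | 20.4202 | 19.5246 | 20.4202 | 26.2466 | 5.8264 |
| 1 | 11604 | 39.0148 | 38.8761 | 39.0148 | 48.3344 | 9.3196 |
| 2 | 5802 | 76.8693 | 77.5793 | 77.5793 | 92.5098 | 14.9305 |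
| 5 | 2321 | 190.7259 | 193.6919 | 193.6919 | 225.0363 | 31.3444 |
| 10 | 1160 | 380.8791 | 387.2217 | 387.2217 | 445.9137 | 58.6920 |
| 20 | 580 | 761.6226 | 774.3089 | 774.3089 | 887.6685 | 113.3596 |
| 40 | 290 | 1523.2400 | 1548.5444 | 1548.5444 | 1771.1781 | 222.6338 |
[cite: Israel1979, Thm. I.2.4] [cite: Ruelle1969, §2.5–2.6] [cite: Ueltschi1999, §3] -/
theorem emeryBoxHg1201CGWSIC_pressureWindowHighT_m49o5 {β : ℝ} (hβ : 0 ≤ β) :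
    HoldsOn (fun p : EmeryCoord → ℝ =>
      max (Real.log (atomicPartitionFnReal β (8837/1000 : ℝ) (917/100 : ℝ)) + 2 * Real.log (atomicPartitionFnReal β (5311/1000 : ℝ) (49/5 : ℝ))) (Real.log (Real.exp (-(β * (-154853677/1000000 : ℝ))) + Real.exp (-(β * (-3869169/25000 : ℝ)))) / 4) ≤ emeryCellPressure β (emeryLine cuprateSigns (emeryLineCoords (((-49/5 : ℚ)) : ℝ) p)) ∧
      emeryCellPressure β (emeryLine cuprateSigns (emeryLineCoords (((-49/5 : ℚ)) : ℝ) p)) ≤ 6 * Real.log 2 + β * (7068077/160000 : ℝ)) emeryBoxHg1201CGWSIC :=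
  fun p hp => ⟨emeryBoxHg1201CGWSIC_pressureFloorBest_m49o5 hβ p hp, by simpa using emeryBoxHg1201CGWSIC_pressureCap_m49o5_retilt hβ p hp⟩

/-- **At β = 0 the window is a point**: `P_cell(0, ·) = 6 log 2` on the whole box (floor and cap coincide). [cite: Ueltschi1999, §3] -/
theorem emeryBoxHg1201CGWSIC_pressure_beta_zero_m49o5 :
    HoldsOn (fun p : EmeryCoord → ℝ => emeryCellPressure 0 (emeryLine cuprateSigns (emeryLineCoords (((-49/5 : ℚ)) : ℝ) p)) = 6 * Real.log 2) emeryBoxHg1201CGWSIC := by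
  intro p hp
  have h := emeryBoxHg1201CGWSIC_pressureWindowHighT_m49o5 le_rfl p hp
  rw [atomicPartitionFnReal_beta_zero, atomicPartitionFnReal_beta_zero, show (4 : ℝ) = 2 ^ 2 by norm_num, Real.log_pow] at h
  simp only [Nat.cast_ofNat, zero_mul, add_zero] at h
  have h1 := (le_max_left _ _).trans h.1
  linarith [h.2]

end Summit.Ventures.CertifiedManyBodySolver.Downfold

end
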